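import Literature.MathematicalPhysics.QuantumFieldTheory.ConformalBootstrap3D.EvenSectorRadialPositivity
import Literature.MathematicalPhysics.QuantumFieldTheory.ConformalBootstrap3D.BlockExistenceLimit
import Literature.MathematicalPhysics.QuantumFieldTheory.ConformalBootstrap3D.PointFunctionalTail
import Mathlib.Tactic
import HarnessLib

/-!
# Hogervorst's reduction formula and even-sector radial positivity at the accidental points (by continuity)

`DimensionalReductionSpin.hrMonomialCoeff_eq_spin_redArr` proves Hogervorst's `3 → 2` reduction formula
at `d = 3` [cite: Hogervorst2016, §2 eqs. (2.24), (2.35)] [cite: PalQiaoRychkov2023, App. A.2 Thm A.5] for `ℓ ≥ 1`,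
`Δ > ℓ + 1` OFF the accidental-degeneracy set (`accidentalDegeneracy3D Δ ℓ`: the finitely many `Δ` at which
the generic coefficient Casimir system is not uniquely solvable, so that the uniqueness step of that proof is
unavailable). Both sides of the identity are continuous in `Δ` on `(ℓ+1, ∞)`:

* the left side `Δ ↦ k^{HR}_{PQ}(Δ, ℓ)` by `IsAdmissible3D.continuousAt_hrMonomialCoeff` (`BlockExistenceLimit`,
  continuity of the Hogervorst–Rychkov recursion at admissible points);
* the right side `Δ ↦ Σ_{a ≤ P, b ≤ Q} c_{ab}(Δ) κ_{α+a}(P-a) κ_{α+b}(Q-b)` because every factor is a ratio of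
  Pochhammer symbols with denominators positive for `α = (Δ-ℓ)/2 > ½` (§1);

and points slightly to the right of any `Δ₀ > ℓ + 1` are regular
(`eventually_isRegularPoint3D_nhdsGT_of_bound_le`), so the identity extends to EVERY `Δ > ℓ + 1`
(`hrMonomialCoeff_eq_spin_redArr_of_lt`, §2). Consequently the function-level reduction
(`hrBlock_hasSum_spin_of_lt`), the non-negativity of the radial monomial array and the unconditional radial
convergence of `EvenSectorRadialPositivity` hold at every `Δ > ℓ + 1` (§3), and — through uniqueness of the
typed block at admissible points (`IsConformalBlock3D.eq_hrBlock_of_isAdmissible`, limit clause included) —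
for every typed even-sector block there (`IsConformalBlock3D.hasSum_zRhoConv_even_of_lt`).

Not covered here: the unitarity bound `Δ = ℓ + 1` itself (`ℓ ≥ 1`), where Hogervorst's closed form
degenerates (`0·∞`); scalars `ℓ = 0` need nothing (no accidental clause in `DimensionalReduction3D`).

pub-ising3d RECIPE R18(iii) (AXIOMS-SOURCES S19.7). No named fact.
-/

namespace Literature.MathematicalPhysics.QuantumFieldTheory.ConformalBootstrap3D

open Finset Set Filter
open scoped Topology

/-! ### §1. Continuity in `Δ` of the right-hand side -/

/-- The Pochhammer product `x ↦ (x)_n` is continuous. [folklore] -/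
theorem continuous_poch (n : ℕ) : Continuous fun x : ℝ => poch x n := by
  unfold poch
  exact continuous_finsetProd _ fun i _ => continuous_id.add continuous_const

/-- `Δ ↦ α = (Δ-ℓ)/2` is continuous. [folklore] -/
theorem continuous_halfTwist (ℓ : ℕ) : Continuous fun Δ : ℝ => halfTwist Δ ℓ := by
  unfold halfTwist
  exact (continuous_id.sub continuous_const).div_const _

/-- `h ↦ κ_h(i)` is continuous at every `h₀ > 0`. [folklore] -/
theorem continuousAt_sl2Coeff {h₀ : ℝ} (hh : 0 < h₀) (i : ℕ) :
    ContinuousAt (fun h : ℝ => sl2Coeff h i) h₀ := by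
  unfold sl2Coeff
  have hnum : Continuous fun h : ℝ => poch h i ^ 2 := (continuous_poch i).pow 2
  have hden : Continuous fun h : ℝ => (i.factorial : ℝ) * poch (2 * h) i :=
    continuous_const.mul ((continuous_poch i).comp (continuous_const.mul continuous_id))
  refine hnum.continuousAt.div hden.continuousAt ?_
  have := poch_pos (by linarith : (0 : ℝ) < 2 * h₀) i
  positivity

/-- `Δ ↦ K_a(m) = κ_{α+a}(m-a)` is continuous at every `Δ₀` with `α₀ > 0`. [folklore] -/
theorem continuousAt_siteK {Δ₀ : ℝ} {ℓ : ℕ} (hα : 0 < halfTwist Δ₀ ℓ) (a : ℕ) (m : ℤ) :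
    ContinuousAt (fun Δ : ℝ => siteK Δ ℓ a m) Δ₀ := by
  rcases lt_or_ge m (a : ℤ) with hlt | hge
  · have : (fun Δ : ℝ => siteK Δ ℓ a m) = fun _ => 0 :=
      funext fun Δ => siteK_eq_zero_of_lt (Δ := Δ) (ℓ := ℓ) a hlt
    rw [this]
    exact continuousAt_const
  · obtain ⟨i, hi⟩ : ∃ i : ℕ, m = ((a + i : ℕ) : ℤ) := ⟨(m - a).toNat, by push_cast; omega⟩
    subst hi
    have : (fun Δ : ℝ => siteK Δ ℓ a ((a + i : ℕ) : ℤ)) = fun Δ => sl2Coeff (halfTwist Δ ℓ + a) i :=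
      funext fun Δ => siteK_add (Δ := Δ) (ℓ := ℓ) a i
    rw [this]
    have hc : ContinuousAt (fun Δ : ℝ => halfTwist Δ ℓ + (a : ℝ)) Δ₀ :=
      ((continuous_halfTwist ℓ).add continuous_const).continuousAt
    have hk : ContinuousAt (fun h : ℝ => sl2Coeff h i) (halfTwist Δ₀ ℓ + (a : ℝ)) :=
      continuousAt_sl2Coeff (by positivity : 0 < halfTwist Δ₀ ℓ + (a : ℝ)) i
    exact ContinuousAt.comp (g := fun h : ℝ => sl2Coeff h i) hk hc

/-- `Δ ↦ G_n(x)` is continuous at every `Δ₀` with `α₀ > ½`. [folklore] -/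
theorem continuousAt_spinG {Δ₀ : ℝ} {ℓ : ℕ} (hα : 1 / 2 < halfTwist Δ₀ ℓ) (n x : ℕ) :
    ContinuousAt (fun Δ : ℝ => spinG Δ ℓ n x) Δ₀ := by
  unfold spinG
  have h1 : Continuous fun Δ : ℝ => poch (halfTwist Δ ℓ + (x : ℝ)) n :=
    (continuous_poch n).comp ((continuous_halfTwist ℓ).add continuous_const)
  have h2 : Continuous fun Δ : ℝ => poch (halfTwist Δ ℓ + (x : ℝ) - 1 / 2) n :=
    (continuous_poch n).comp (((continuous_halfTwist ℓ).add continuous_const).sub continuous_const)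
  have hne : poch (halfTwist Δ₀ ℓ + (x : ℝ) - 1 / 2) n ≠ 0 :=
    poch_ne_zero (by have := (Nat.cast_nonneg x : (0 : ℝ) ≤ x); linarith) n
  exact continuousAt_const.mul (h1.continuousAt.div h2.continuousAt hne)

/-- `Δ ↦ E_n` is continuous at every `Δ₀` with `α₀ > ½`. [folklore] -/
theorem continuousAt_spinE {Δ₀ : ℝ} {ℓ : ℕ} (hα : 1 / 2 < halfTwist Δ₀ ℓ) (n : ℕ) :
    ContinuousAt (fun Δ : ℝ => spinE Δ ℓ n) Δ₀ := by
  unfold spinE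
  have hΔ : (ℓ : ℝ) + 1 < Δ₀ := by unfold halfTwist at hα; linarith
  have hl0 : (0 : ℝ) ≤ ℓ := Nat.cast_nonneg ℓ
  have hnum : Continuous fun Δ : ℝ => poch (1 / 2) n * poch (Δ - 1) n * poch (halfTwist Δ ℓ + ℓ) n *
      poch (halfTwist Δ ℓ - 1 / 2) n :=
    ((continuous_const.mul ((continuous_poch n).comp (continuous_id.sub continuous_const))).mul
      ((continuous_poch n).comp ((continuous_halfTwist ℓ).add continuous_const))).mul
      ((continuous_poch n).comp ((continuous_halfTwist ℓ).sub continuous_const))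
  have hden : Continuous fun Δ : ℝ => (16 : ℝ) ^ n * (n.factorial : ℝ) * poch (Δ - 1 / 2) n *
      poch (halfTwist Δ ℓ + ℓ + 1 / 2) n * poch (halfTwist Δ ℓ) n :=
    (((continuous_const.mul ((continuous_poch n).comp (continuous_id.sub continuous_const))).mul
      ((continuous_poch n).comp (((continuous_halfTwist ℓ).add continuous_const).add continuous_const))).mul
      ((continuous_poch n).comp (continuous_halfTwist ℓ)))
  refine hnum.continuousAt.div hden.continuousAt ?_
  have h1 := poch_pos (by linarith : (0 : ℝ) < Δ₀ - 1 / 2) n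
  have h2 := poch_pos (by linarith : (0 : ℝ) < halfTwist Δ₀ ℓ + ℓ + 1 / 2) n
  have h3 := poch_pos (by linarith : (0 : ℝ) < halfTwist Δ₀ ℓ) n
  positivity

/-- `Δ ↦ c_{ab}(Δ)` (Hogervorst's site function) is continuous at every `Δ₀` with `α₀ > ½`. [folklore] -/
theorem continuousAt_spinSite {Δ₀ : ℝ} {ℓ : ℕ} (hα : 1 / 2 < halfTwist Δ₀ ℓ) (a b : ℕ) :
    ContinuousAt (fun Δ : ℝ => spinSite Δ ℓ a b) Δ₀ := by
  by_cases h : ℓ ≤ a + b ∧ (a + b + ℓ) % 2 = 0 ∧ a ≤ b + ℓ ∧ b ≤ a + ℓ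
  · have hfun : (fun Δ : ℝ => spinSite Δ ℓ a b) = fun Δ =>
        spinG Δ ℓ ((a + b - ℓ) / 2) (a - (a + b - ℓ) / 2) * spinG Δ ℓ ((a + b - ℓ) / 2) (b - (a + b - ℓ) / 2)
          * spinE Δ ℓ ((a + b - ℓ) / 2) / legendreLam ℓ := by
      funext Δ; unfold spinSite; rw [if_pos h]
    rw [hfun]
    exact (((continuousAt_spinG hα _ _).mul (continuousAt_spinG hα _ _)).mul
      (continuousAt_spinE hα _)).div_const _
  · have hfun : (fun Δ : ℝ => spinSite Δ ℓ a b) = fun _ => 0 := by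
      funext Δ; unfold spinSite; rw [if_neg h]
    rw [hfun]
    exact continuousAt_const

/-- `Δ ↦ redArr Δ ℓ (spinSite Δ ℓ) (P,Q)` is continuous at every `Δ₀` with `α₀ > ½` (finite sum of
products of continuous factors). [folklore] -/
theorem continuousAt_redArr_spinSite {Δ₀ : ℝ} {ℓ : ℕ} (hα : 1 / 2 < halfTwist Δ₀ ℓ) (p : ℕ × ℕ) :
    ContinuousAt (fun Δ : ℝ => redArr Δ ℓ (spinSite Δ ℓ) p) Δ₀ := by
  unfold redArr
  refine tendsto_finsetSum _ fun a _ => tendsto_finsetSum _ fun b _ => ?_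
  exact ((continuousAt_spinSite hα a b).mul (continuousAt_siteK (by linarith) a _)).mul
    (continuousAt_siteK (by linarith) b _)

/-! ### §2. The reduction formula at every `Δ > ℓ + 1` -/

/-- **Hogervorst's reduction formula at `d = 3` for every `Δ > ℓ + 1`, `ℓ ≥ 1` — accidental points
included.** Both sides are continuous in `Δ` at `Δ₀`, and they agree at all regular points, which are
eventually all points to the right of `Δ₀`. [cite: Hogervorst2016, §2 eqs. (2.24), (2.35)]
[cite: PalQiaoRychkov2023, App. A.2 Thm A.5] [cite: Song2025, §1] -/
theorem hrMonomialCoeff_eq_spin_redArr_of_lt {Δ₀ : ℝ} {ℓ : ℕ} (hℓ : 1 ≤ ℓ) (hΔ : (ℓ : ℝ) + 1 < Δ₀) :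
    hrMonomialCoeff Δ₀ ℓ = redArr Δ₀ ℓ (spinSite Δ₀ ℓ) := by
  have hb : unitarityBound3D ℓ < Δ₀ := unitarityBound3D_spin_lt hℓ hΔ
  have hα : 1 / 2 < halfTwist Δ₀ ℓ := by unfold halfTwist; linarith
  funext p
  have hf : Tendsto (fun Δ => hrMonomialCoeff Δ ℓ p) (𝓝[>] Δ₀) (𝓝 (hrMonomialCoeff Δ₀ ℓ p)) :=
    ((isAdmissible3D_of_lt hb).continuousAt_hrMonomialCoeff p).mono_left nhdsWithin_le_nhds
  have hg : Tendsto (fun Δ => redArr Δ ℓ (spinSite Δ ℓ) p) (𝓝[>] Δ₀)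
      (𝓝 (redArr Δ₀ ℓ (spinSite Δ₀ ℓ) p)) :=
    (continuousAt_redArr_spinSite hα p).mono_left nhdsWithin_le_nhds
  have hev : ∀ᶠ Δ in 𝓝[>] Δ₀, hrMonomialCoeff Δ ℓ p = redArr Δ ℓ (spinSite Δ ℓ) p := by
    filter_upwards [eventually_isRegularPoint3D_nhdsGT_of_bound_le hb.le,
      Ioo_mem_nhdsGT (show Δ₀ < Δ₀ + 1 by linarith)] with Δ hreg hΔ'
    have hlt : (ℓ : ℝ) + 1 < Δ := hΔ.trans hΔ'.1
    exact congr_fun (hrMonomialCoeff_eq_spin_redArr hℓ hlt hreg.2) p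
  exact tendsto_nhds_unique_of_eventuallyEq hf hg hev

/-- Entrywise form at every `Δ > ℓ + 1`: `k^{HR}_{PQ}(Δ,ℓ) = Σ_{a ≤ P} Σ_{b ≤ Q} c_{ab} K_a(P) K_b(Q)`.
[cite: Hogervorst2016, §2 eqs. (2.24), (2.35)] -/
theorem hrMonomialCoeff_spin_apply_of_lt {Δ : ℝ} {ℓ : ℕ} (hℓ : 1 ≤ ℓ) (hΔ : (ℓ : ℝ) + 1 < Δ) (P Q : ℕ) :
    hrMonomialCoeff Δ ℓ (P, Q) = ∑ a ∈ range (P + 1), ∑ b ∈ range (Q + 1),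
      spinSite Δ ℓ a b * siteK Δ ℓ a P * siteK Δ ℓ b Q := by
  rw [hrMonomialCoeff_eq_spin_redArr_of_lt hℓ hΔ]
  rfl

/-! ### §3. Consequences at every `Δ > ℓ + 1`: function level and radial positivity -/

/-- **Function-level reduction at every `Δ > ℓ + 1`** (accidental points included):
`g^{HR}_{Δ,ℓ}(x,y) = Σ_{a,b} c_{ab} k_{2(α+a)}(x) k_{2(α+b)}(y)` on the open square.
[cite: Hogervorst2016, §2 eqs. (2.24), (2.35)] [cite: PalQiaoRychkov2023, App. A.2 Thm A.5] -/
theorem hrBlock_hasSum_spin_of_lt {Δ : ℝ} {ℓ : ℕ} (hℓ : 1 ≤ ℓ) (hΔ : (ℓ : ℝ) + 1 < Δ)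
    {x y : ℝ} (hx0 : 0 < x) (hx1 : x < 1) (hy0 : 0 < y) (hy1 : y < 1) :
    HasSum (fun p : ℕ × ℕ =>
      spinSite Δ ℓ p.1 p.2 * sl2Block (halfTwist Δ ℓ + p.1) x * sl2Block (halfTwist Δ ℓ + p.2) y)
      (hrBlock Δ ℓ x y) :=
  hasSum_redArr_sl2Block (unitarityBound3D_spin_lt hℓ hΔ) (halfTwist_spin_gt hΔ) (spinSite Δ ℓ)
    (spinSite_nonneg hΔ) (hrMonomialCoeff_eq_spin_redArr_of_lt hℓ hΔ) hx0 hx1 hy0 hy1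

/-- **Radial monomial array `≥ 0` at every `Δ > ℓ + 1`, `ℓ ≥ 1`.** [cite: HogervorstRychkov2013, §3.1]
[cite: Hogervorst2016, §2 eqs. (2.24), (2.35)] -/
theorem zRhoConv_nonneg_spin_of_lt {Δ : ℝ} {ℓ : ℕ} (hℓ : 1 ≤ ℓ) (hΔ : (ℓ : ℝ) + 1 < Δ) (p : ℕ × ℕ) :
    0 ≤ zRhoConv 0 Δ ℓ (hrRadA Δ ℓ) p :=
  zRhoConv_nonneg_of_redArr (unitarityBound3D_spin_lt hℓ hΔ) (halfTwist_spin_gt hΔ) (spinSite Δ ℓ)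
    (spinSite_nonneg hΔ) (hrMonomialCoeff_eq_spin_redArr_of_lt hℓ hΔ) p

/-- **Unconditional radial convergence on the whole square at every `Δ > ℓ + 1`, `ℓ ≥ 1`.**
[cite: HogervorstRychkov2013, §3.1] [cite: Hogervorst2016, §2 eqs. (2.24), (2.35)] -/
theorem hasSum_zRhoConv_hrBlock_spin_of_lt {Δ : ℝ} {ℓ : ℕ} (hℓ : 1 ≤ ℓ) (hΔ : (ℓ : ℝ) + 1 < Δ)
    {s u : ℝ} (hs0 : 0 < s) (hs1 : s < 1) (hu0 : 0 < u) (hu1 : u < 1) :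
    HasSum (fun p : ℕ × ℕ => zRhoConv 0 Δ ℓ (hrRadA Δ ℓ) p * (s ^ p.1 * u ^ p.2))
      ((s * u) ^ (-(Δ - (ℓ : ℝ))) * (4 : ℝ) ^ (-Δ) * hrBlock Δ ℓ (zOfRho (s ^ 2)) (zOfRho (u ^ 2))) :=
  hasSum_zRhoConv_hrBlock (unitarityBound3D_spin_lt hℓ hΔ) (halfTwist_spin_gt hΔ) (spinSite Δ ℓ)
    (spinSite_nonneg hΔ) (hrMonomialCoeff_eq_spin_redArr_of_lt hℓ hΔ) hs0 hs1 hu0 hu1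

/-- **Typed form at every `Δ > ℓ + 1`, `ℓ ≥ 1`** (the typed predicate's limit clause covers the accidental
points; uniqueness there is `IsConformalBlock3D.eq_hrBlock_of_isAdmissible`): every genuine even-sector
block `g` has the non-negative, everywhere-convergent radial monomial expansion.
[cite: HogervorstRychkov2013, §3 after eq. (3.5)] -/
theorem IsConformalBlock3D.hasSum_zRhoConv_even_of_lt {Δ : ℝ} {ℓ : ℕ} {g : ℝ → ℝ → ℝ} (hℓ : 1 ≤ ℓ)
    (hΔ : (ℓ : ℝ) + 1 < Δ) (hg : IsConformalBlock3D 0 0 Δ ℓ g)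
    {s u : ℝ} (hs0 : 0 < s) (hs1 : s < 1) (hu0 : 0 < u) (hu1 : u < 1) :
    HasSum (fun p : ℕ × ℕ => zRhoConv 0 Δ ℓ (hrRadA Δ ℓ) p * (s ^ p.1 * u ^ p.2))
      ((s * u) ^ (-(Δ - (ℓ : ℝ))) * (4 : ℝ) ^ (-Δ) * g (zOfRho (s ^ 2)) (zOfRho (u ^ 2))) := by
  have hs2 : s ^ 2 < 1 := by nlinarith
  have hu2 : u ^ 2 < 1 := by nlinarith
  have hx : zOfRho (s ^ 2) ∈ Ioo (0 : ℝ) 1 :=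
    ⟨zOfRho_pos (pow_pos hs0 2), zOfRho_lt_one (by nlinarith) hs2.ne⟩
  have hy : zOfRho (u ^ 2) ∈ Ioo (0 : ℝ) 1 :=
    ⟨zOfRho_pos (pow_pos hu0 2), zOfRho_lt_one (by nlinarith) hu2.ne⟩
  rw [hg.eq_hrBlock_of_isAdmissible (isAdmissible3D_of_lt (unitarityBound3D_spin_lt hℓ hΔ)) _ _ hx hy]
  exact hasSum_zRhoConv_hrBlock_spin_of_lt hℓ hΔ hs0 hs1 hu0 hu1

end Literature.MathematicalPhysics.QuantumFieldTheory.ConformalBootstrap3D
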